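import Summits.CriticalPhenomena.SAWScalingLimit.Theorems.SAWLoopFugacityFlowIsingBoundaryRatioWindowRectNonInterleave
import HarnessLib

/-!
# Non-interleaving: exterior square chains between interleaved boundary darts meet (the theorem)
(line `fk-anchor-transfer`, crux `IsingBoundaryRatio`, stmt-CriticalPhenomena-10650; helper file of the stub
`windowRectPresentation_holds`)

`nonInterleave`: see the module docstring of `…WindowRectNonInterleave` for the statement and the proof.
This file carries out the winding-number bookkeeping: the pieces of the loop avoid the test segments and the
inside / outside joins, the arc contributes the jumps, and Eilenberg's constancy of winding numbers on
complementary components gives the contradiction. [folklore]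
-/

noncomputable section

open scoped Classical Real
open Set Complex Literature.Probability.LatticeModels Literature.Probability.LatticeModels.DiscreteRect
open Literature.Topology.PlaneTopology

namespace Summit.CriticalPhenomena.SAWScalingLimit.Theorems.IsingBoundaryRatio

namespace WindowRect

variable {E : Finset (Sym2 (Site 2))}

/-! ### Pointwise avoidance of the polygon (mesh `1`, offset `1/4`) -/

section Avoid

variable (hE : ∀ e ∈ E, e ∈ (zdGraph 2).edgeSet) {d₀ : Site 2 × Fin 4} (hd₀ : IsExtDart E d₀) (n : ℕ)
include hd₀

/-- A point `framePt 1 (x, k) a b`, `|a|, |b| < 1/4`, is off the polygon. [folklore] -/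
theorem inside_not_mem_range {x : Site 2} {k : Fin 4} {a b : ℝ} (ha : |a| < 1 / 4) (hb : |b| < 1 / 4) :
    framePt 1 (x, k) a b ∉ range (arcPath E 1 (1 / 4) d₀ n) := by
  intro hz
  rcases side_or_conn_of_mem_range (by norm_num) (by norm_num) hd₀ n hz with ⟨v, K, -, h⟩ | ⟨e, he, t, ht, h⟩
  · exact inside_not_side one_pos (by norm_num) (by norm_num) ha hb h
  · exact inside_not_conn one_pos (by norm_num) (by norm_num) ha hb he ht h

include hE in
/-- A point of an edge of `E` is off the polygon. [folklore] -/
theorem edge_not_mem_range {v w : Site 2} (hvw : s(v, w) ∈ E) {z : ℂ} (hz : z ∈ segment ℝ (meshPoint 1 v) (meshPoint 1 w)) :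
    z ∉ range (arcPath E 1 (1 / 4) d₀ n) := by
  have hadj : (zdGraph 2).Adj v w := by
    have := hE _ hvw; rwa [SimpleGraph.mem_edgeSet] at this
  obtain ⟨K, rfl⟩ := exists_eq_add_dir_of_adj hadj
  obtain ⟨t, ht, rfl⟩ := exists_of_mem_edge one_pos hz
  intro hzΓ
  rcases le_or_gt t (1 / 2) with htle | htgt
  · rcases side_or_conn_of_mem_range (by norm_num) (by norm_num) hd₀ n hzΓ with ⟨v', K', hext, h⟩ | ⟨a, ha', t', ht', h⟩
    · exact edgeLine_not_side one_pos (by norm_num) (by norm_num) (x := v) (k := K) hvw ⟨ht.1, htle⟩ hext h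
    · exact edgeLine_not_conn one_pos (by norm_num) (by norm_num) ⟨ht.1, htle⟩ ha' ht' h
  · have hrev : framePt 1 (v, K) t 0 = framePt 1 (v + dir K, K + 2) (1 - t) 0 := by
      rw [framePt_reverse v K t 0, neg_zero]
    have hvw' : aedge (v + dir K, K + 2) ∈ E := by rw [aedge_reverse]; exact hvw
    rw [hrev] at hzΓ
    rcases side_or_conn_of_mem_range (by norm_num) (by norm_num) hd₀ n hzΓ with ⟨v', K', hext, h⟩ | ⟨a, ha', t', ht', h⟩
    · exact edgeLine_not_side one_pos (by norm_num) (by norm_num) hvw' ⟨by linarith [ht.2], by linarith⟩ hext h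
    · exact edgeLine_not_conn one_pos (by norm_num) (by norm_num) ⟨by linarith [ht.2], by linarith⟩ ha' ht' h

/-- An interior axis point `framePt 1 (x, k) s 0`, `1/4 < s < 1`, of a missing edge whose far end is not a
vertex... of a missing edge, with `s ≤ 1/2`, is off the polygon. [folklore] -/
theorem axis_not_mem_range {x : Site 2} {k : Fin 4} {s : ℝ} (hs : s ∈ Ioc (1 / 4 : ℝ) (1 / 2)) :
    framePt 1 (x, k) s 0 ∉ range (arcPath E 1 (1 / 4) d₀ n) :=
  tail_not_mem_range_arcPath one_pos (by norm_num) (by norm_num) hd₀ n hs.1 (by linarith [hs.2])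
    (fun _ => by linarith [hs.2])

/-- A point `framePt 1 (x, k) (1/2) c`, `|c| ≤ 1/2`, across a missing edge is off the polygon. [folklore] -/
theorem centerLine_not_mem_range {x : Site 2} {k : Fin 4} (hxk : s(x, x + dir k) ∉ E) {c : ℝ} (hc : |c| ≤ 1 / 2) :
    framePt 1 (x, k) (1 / 2) c ∉ range (arcPath E 1 (1 / 4) d₀ n) := by
  intro hz
  rcases side_or_conn_of_mem_range (by norm_num) (by norm_num) hd₀ n hz with ⟨v, K, -, h⟩ | ⟨e, he, t, ht, h⟩
  · exact centerLine_not_side one_pos (by norm_num : (0 : ℝ) < 1 / 4) (by norm_num) hc h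
  · exact centerLine_not_conn one_pos (by norm_num : (0 : ℝ) < 1 / 4) (by norm_num) (x := x) (k := k) hxk hc he ht h

/-- An approach point `framePt 1 (x, k) s c`, `1/4 < s ≤ 1/2`, `0 < c < 1/4`, is off the polygon. [folklore] -/
theorem approach_not_mem_range {x : Site 2} {k : Fin 4} {s c : ℝ} (hs : s ∈ Ioc (1 / 4 : ℝ) (1 / 2))
    (hc : c ∈ Ioo (0 : ℝ) (1 / 4)) : framePt 1 (x, k) s c ∉ range (arcPath E 1 (1 / 4) d₀ n) := by
  intro hz
  rcases side_or_conn_of_mem_range (by norm_num) (by norm_num) hd₀ n hz with ⟨v, K, -, h⟩ | ⟨e, he, t, ht, h⟩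
  · exact approach_not_side one_pos (by norm_num) (by norm_num) hs hc h
  · exact approach_not_conn one_pos (by norm_num) (by norm_num) hs hc he ht h

/-- The segment between the centres of two side-adjacent squares across a side not in `E` is off the polygon.
[folklore] -/
theorem segment_ctr_not_mem_range {a : Site 2} {i : Fin 4} (hne : s(corner a i, corner a i + dir i) ∉ E) {z : ℂ}
    (hz : z ∈ segment ℝ (ctr a) (ctr (a + dir (i + 3)))) : z ∉ range (arcPath E 1 (1 / 4) d₀ n) := by
  obtain ⟨c, hc, rfl⟩ := exists_of_mem_segment_ctr hz
  exact centerLine_not_mem_range hd₀ n hne hc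

/-- The centre of a unit square is off the polygon. [folklore] -/
theorem ctr_not_mem_range (g : Site 2) : ctr g ∉ range (arcPath E 1 (1 / 4) d₀ n) := by
  intro hz
  rw [ctr_corner g 0] at hz
  rcases side_or_conn_of_mem_range (by norm_num) (by norm_num) hd₀ n hz with ⟨v, K, -, h⟩ | ⟨e, he, t, ht, h⟩
  · exact centerLine_not_side one_pos (by norm_num : (0 : ℝ) < 1 / 4) (by norm_num)
      (by rw [abs_of_pos (by norm_num : (0 : ℝ) < 1 / 2)]) h
  · exact center_not_conn one_pos (by norm_num : (0 : ℝ) < 1 / 4) (by norm_num) he ht h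

end Avoid

/-! ### Test segments -/

/-- A point of the test segment of the arrow `(x, k)` is a frame point with coordinates in `(0, 1)`. [folklore] -/
theorem exists_of_mem_testSegment' {x : Site 2} {k : Fin 4} {z : ℂ}
    (hz : z ∈ segment ℝ (framePt 1 (x, k) (1 / 4 - 1 / 4 / 4) (1 / 4 / 2)) (framePt 1 (x, k) (1 / 4 + 1 / 4 / 4) (1 / 4 / 2))) :
    ∃ a b : ℝ, a ∈ Ioo (0 : ℝ) 1 ∧ b ∈ Ioo (0 : ℝ) 1 ∧ z = framePt 1 (x, k) a b := by
  obtain ⟨u, hu, rfl⟩ := exists_of_mem_testSegment (by norm_num : (0 : ℝ) < 1 / 4) x k hz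
  obtain ⟨hu1, hu2⟩ := abs_lt.1 hu
  exact ⟨1 / 4 + u, 1 / 4 / 2, ⟨by linarith, by linarith⟩, ⟨by norm_num, by norm_num⟩, rfl⟩

/-! ### The theorem -/

/-- **Non-interleaving.** See the module docstring of `…WindowRectNonInterleave`. [folklore] -/
theorem nonInterleave (hE : ∀ e ∈ E, e ∈ (zdGraph 2).edgeSet)
    (hconn : ∀ x ∈ verts E, ∀ y ∈ verts E, Relation.ReflTransGen (fun a b : Site 2 => s(a, b) ∈ E) x y)
    {d₀ : Site 2 × Fin 4} (hd₀ : IsExtDart E d₀) {N : ℕ}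
    (hinj : ∀ i j, i < N → j < N → (succ E)^[i] d₀ = (succ E)^[j] d₀ → i = j)
    {j l m : ℕ} (hj : 0 < j) (hjl : j < l) (hlm : l < m) (hmN : m < N)
    {CA CB : Set (Site 2)} (hdis : Disjoint CA CB)
    (h0A : quad d₀.1 d₀.2 ∈ CA) (hlA : quad ((succ E)^[l] d₀).1 ((succ E)^[l] d₀).2 ∈ CA)
    (hjB : quad ((succ E)^[j] d₀).1 ((succ E)^[j] d₀).2 ∈ CB) (hmB : quad ((succ E)^[m] d₀).1 ((succ E)^[m] d₀).2 ∈ CB)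
    (hA : Relation.ReflTransGen (fun p q : Site 2 => p ∈ CA ∧ q ∈ CA ∧ ∃ i : Fin 4, q = p + dir (i + 3) ∧
      s(corner p i, corner p i + dir i) ∉ E) (quad ((succ E)^[l] d₀).1 ((succ E)^[l] d₀).2) (quad d₀.1 d₀.2))
    (hB : Relation.ReflTransGen (fun p q : Site 2 => p ∈ CB ∧ q ∈ CB ∧ ∃ i : Fin 4, q = p + dir (i + 3) ∧
      s(corner p i, corner p i + dir i) ∉ E) (quad ((succ E)^[j] d₀).1 ((succ E)^[j] d₀).2)
      (quad ((succ E)^[m] d₀).1 ((succ E)^[m] d₀).2)) : False := by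
  obtain ⟨x0, k0⟩ := d₀
  obtain ⟨⟨xj, kj⟩, hxj⟩ : ∃ p : Site 2 × Fin 4, (succ E)^[j] (x0, k0) = p := ⟨_, rfl⟩
  obtain ⟨⟨xl, kl⟩, hxl⟩ : ∃ p : Site 2 × Fin 4, (succ E)^[l] (x0, k0) = p := ⟨_, rfl⟩
  obtain ⟨⟨xm, km⟩, hxm⟩ : ∃ p : Site 2 × Fin 4, (succ E)^[m] (x0, k0) = p := ⟨_, rfl⟩
  simp only [hxj, hxl, hxm] at hlA hjB hmB hA hB
  dsimp only at h0A hlA hjB hmB hA hB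
  have hN0 : 0 < N := by omega
  have hjN : j < N := by omega
  have hlN : l < N := by omega
  have hextj : IsExtDart E (xj, kj) := hxj ▸ hd₀.iterate j
  have hextl : IsExtDart E (xl, kl) := hxl ▸ hd₀.iterate l
  have hextm : IsExtDart E (xm, km) := hxm ▸ hd₀.iterate m
  -- squares off the other family
  have hQjA : quad xj kj ∉ CA := fun h => Set.disjoint_left.1 hdis h hjB
  have hQmA : quad xm km ∉ CA := fun h => Set.disjoint_left.1 hdis h hmB
  have hQlB : quad xl kl ∉ CB := fun h => Set.disjoint_left.1 hdis hlA h
  have hQ0B : quad x0 k0 ∉ CB := fun h => Set.disjoint_left.1 hdis h0A h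
  -- numerics
  have hδ : (0 : ℝ) < 1 := one_pos
  have hη : (0 : ℝ) < 1 / 4 := by norm_num
  have h4 : 4 * (1 / 4 : ℝ) ≤ 1 := by norm_num
  have hI01 : (1 / 2 : ℝ) ∈ Ioo (0 : ℝ) 1 := ⟨by norm_num, by norm_num⟩
  -- the allowed set of the closing path and the chain path through `CA`
  set SA : Set ℂ := closingSet' E CA (xl, kl) (x0, k0) with hSA
  obtain ⟨PA, hPA⟩ := exists_path_ctr (E := E) (S := SA) (𝒞 := CA)
    (fun a ha => Or.inl (mem_closingSet_of_openSq ha (ctr_mem_openSq a)))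
    (fun a i ha hb hne z hz => Or.inl (segment_ctr_subset_closingSet ha hb hne hz)) hlA hA
  -- the closing pieces at `d_l` and `d₀`
  have e_l : framePt 1 ((succ E)^[l] (x0, k0)) (1 / 4) 0 = framePt 1 (xl, kl) (1 / 4) 0 := by rw [hxl]
  set P1 : Path (framePt 1 ((succ E)^[l] (x0, k0)) (1 / 4) 0) (ctr (quad xl kl)) :=
    ((Path.segment (framePt 1 (xl, kl) (1 / 4) 0) (framePt 1 (xl, kl) (1 / 2) 0)).trans
      (Path.segment (framePt 1 (xl, kl) (1 / 2) 0) (ctr (quad xl kl)))).cast e_l rfl with hP1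
  set P3 : Path (ctr (quad x0 k0)) (framePt 1 (x0, k0) (1 / 4) 0) :=
    (Path.segment (ctr (quad x0 k0)) (framePt 1 (x0, k0) (1 / 2) 0)).trans
      (Path.segment (framePt 1 (x0, k0) (1 / 2) 0) (framePt 1 (x0, k0) (1 / 4) 0)) with hP3
  have axis_mem : ∀ {x : Site 2} {k : Fin 4} {z : ℂ}, ((x, k) = (xl, kl) ∨ (x, k) = (x0, k0)) → quad x k ∈ CA →
      z ∈ segment ℝ (framePt 1 (x, k) (1 / 4) 0) (framePt 1 (x, k) (1 / 2) 0) ∨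
        z ∈ segment ℝ (framePt 1 (x, k) (1 / 2) 0) (ctr (quad x k)) → z ∈ SA := by
    intro x k z hxk hq hz
    rcases hz with hz | hz
    · obtain ⟨s, hs, rfl⟩ := mem_segment_bud_mid hz
      have hs' : s ∈ Ioo (0 : ℝ) 1 := ⟨by linarith [hs.1], by linarith [hs.2]⟩
      rcases hxk with h | h <;> rw [h]
      · exact Or.inr ⟨s, hs', Or.inl rfl⟩
      · exact Or.inr ⟨s, hs', Or.inr rfl⟩
    · rcases mem_segment_mid_ctr hz with rfl | h
      · rcases hxk with h | h <;> rw [h]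
        · exact Or.inr ⟨1 / 2, hI01, Or.inl rfl⟩
        · exact Or.inr ⟨1 / 2, hI01, Or.inr rfl⟩
      · exact Or.inl (mem_closingSet_of_openSq hq h)
  have hP1 : ∀ z ∈ range P1, z ∈ SA := by
    intro z hz
    rw [hP1, Path.cast_coe, Path.trans_range, Path.range_segment, Path.range_segment] at hz
    exact axis_mem (Or.inl rfl) hlA hz
  have hP3 : ∀ z ∈ range P3, z ∈ SA := by
    intro z hz
    rw [hP3, Path.trans_range, Path.range_segment, Path.range_segment, segment_symm ℝ (ctr _),
      segment_symm ℝ (framePt 1 (x0, k0) (1 / 2) 0) (framePt 1 (x0, k0) (1 / 4) 0)] at hz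
    exact axis_mem (Or.inr rfl) h0A hz.symm
  -- the loop
  set P0 := arcPath E 1 (1 / 4) (x0, k0) l with hP0
  set C : Path (framePt 1 (x0, k0) (1 / 4) 0) (framePt 1 (x0, k0) (1 / 4) 0) :=
    P0.trans (P1.trans (PA.trans P3)) with hC
  have hCsub : ∀ z ∈ range C, z ∈ range (arcPath E 1 (1 / 4) (x0, k0) N) ∨ z ∈ SA := by
    intro z hz
    rw [hC, Path.trans_range, Path.trans_range, Path.trans_range] at hz
    rcases hz with hz | hz | hz | hz
    · exact Or.inl (range_arcPath_mono _ hlN.le hz)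
    · exact Or.inr (hP1 z hz)
    · exact Or.inr (hPA z hz)
    · exact Or.inr (hP3 z hz)
  have notC : ∀ {z : ℂ}, z ∉ range (arcPath E 1 (1 / 4) (x0, k0) N) → z ∉ SA → z ∈ (range C)ᶜ :=
    fun h1 h2 hz => (hCsub _ hz).elim h1 h2
  -- points of `closingSet CB` are off `SA`
  have hSB : ∀ z ∈ closingSet E CB, z ∉ SA := by
    rintro z hz (h | ⟨s, hs, rfl | rfl⟩)
    · exact disjoint_closingSet hdis h hz
    · exact framePt_axis_not_mem_closingSet hQlB hs hz
    · exact framePt_axis_not_mem_closingSet hQ0B hs hz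
  -- test segments of `d_j`, `d_m` avoid `SA`, test points avoid the pieces
  have test_not_SA : ∀ {x : Site 2} {k : Fin 4}, quad x k ∉ CA → ∀ z ∈ segment ℝ
      (framePt 1 (x, k) (1 / 4 - 1 / 4 / 4) (1 / 4 / 2)) (framePt 1 (x, k) (1 / 4 + 1 / 4 / 4) (1 / 4 / 2)), z ∉ SA := by
    intro x k hq z hz
    obtain ⟨a, b, ha, hb, rfl⟩ := exists_of_mem_testSegment' hz
    exact framePt_not_mem_closingSet' hq ha hb
  have testPt_not_Γ : ∀ (x : Site 2) (k : Fin 4) (n : ℕ),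
      framePt 1 (x, k) (1 / 4 - 1 / 4 / 4) (1 / 4 / 2) ∉ range (arcPath E 1 (1 / 4) (x0, k0) n) ∧
        framePt 1 (x, k) (1 / 4 + 1 / 4 / 4) (1 / 4 / 2) ∉ range (arcPath E 1 (1 / 4) (x0, k0) n) := by
    intro x k n
    obtain ⟨hn, hp, hn0, hp0⟩ := test_offsets hη
    have h1 := testPt_not_mem_range_arcPath (E := E) hδ hη h4 x k hn hn0 (x0, k0) n
    rw [show (1 / 4 : ℝ) + -(1 / 4 / 4) = 1 / 4 - 1 / 4 / 4 by ring] at h1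
    exact ⟨h1, testPt_not_mem_range_arcPath (E := E) hδ hη h4 x k hp hp0 (x0, k0) n⟩
  -- crossing defects of the loop across the two test segments
  have cross : ∀ {x : Site 2} {k : Fin 4}, quad x k ∉ CA →
      C.crossInc (framePt 1 (x, k) (1 / 4 - 1 / 4 / 4) (1 / 4 / 2)) (framePt 1 (x, k) (1 / 4 + 1 / 4 / 4) (1 / 4 / 2)) =
        P0.crossInc (framePt 1 (x, k) (1 / 4 - 1 / 4 / 4) (1 / 4 / 2)) (framePt 1 (x, k) (1 / 4 + 1 / 4 / 4) (1 / 4 / 2)) := by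
    intro x k hq
    set ℓ := framePt 1 (x, k) (1 / 4 - 1 / 4 / 4) (1 / 4 / 2) with hℓ
    set r := framePt 1 (x, k) (1 / 4 + 1 / 4 / 4) (1 / 4 / 2) with hr
    have hℓSA : ℓ ∉ SA := test_not_SA hq ℓ (left_mem_segment _ _ _)
    have hrSA : r ∉ SA := test_not_SA hq r (right_mem_segment _ _ _)
    have z1 : P1.crossInc ℓ r = 0 := Path.crossInc_eq_zero _ fun t ht => test_not_SA hq _ ht (hP1 _ ⟨t, rfl⟩)
    have zA : PA.crossInc ℓ r = 0 := Path.crossInc_eq_zero _ fun t ht => test_not_SA hq _ ht (hPA _ ⟨t, rfl⟩)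
    have z3 : P3.crossInc ℓ r = 0 := Path.crossInc_eq_zero _ fun t ht => test_not_SA hq _ ht (hP3 _ ⟨t, rfl⟩)
    have n1 : ∀ {p : ℂ}, p ∉ SA → p ∉ range P1 := fun hp h => hp (hP1 _ h)
    have nA : ∀ {p : ℂ}, p ∉ SA → p ∉ range PA := fun hp h => hp (hPA _ h)
    have n3 : ∀ {p : ℂ}, p ∉ SA → p ∉ range P3 := fun hp h => hp (hP3 _ h)
    have nA3 : ∀ {p : ℂ}, p ∉ SA → p ∉ range (PA.trans P3) := fun hp h => by
      rw [Path.trans_range] at h; exact h.elim (nA hp) (n3 hp)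
    have n1A3 : ∀ {p : ℂ}, p ∉ SA → p ∉ range (P1.trans (PA.trans P3)) := fun hp h => by
      rw [Path.trans_range] at h; exact h.elim (n1 hp) (nA3 hp)
    obtain ⟨n0ℓ, n0r⟩ := testPt_not_Γ x k l
    rw [hC, Path.crossInc_trans _ _ n0ℓ (n1A3 hℓSA) n0r (n1A3 hrSA),
      Path.crossInc_trans _ _ (n1 hℓSA) (nA3 hℓSA) (n1 hrSA) (nA3 hrSA),
      Path.crossInc_trans _ _ (nA hℓSA) (n3 hℓSA) (nA hrSA) (n3 hrSA), z1, zA, z3]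
    ring
  -- the arc contributes `2πi` at `d_j` and `0` at `d_m`
  have c0j : P0.crossInc (framePt 1 (xj, kj) (1 / 4 - 1 / 4 / 4) (1 / 4 / 2))
      (framePt 1 (xj, kj) (1 / 4 + 1 / 4 / 4) (1 / 4 / 2)) = 2 * π * I := by
    rw [hP0, crossInc_arcPath hδ hη h4 xj kj l (x0, k0), Finset.sum_eq_single j, if_pos hxj]
    · intro i hi hij
      rw [if_neg]
      intro h
      exact hij (hinj i j ((Finset.mem_range.1 hi).trans hlN) hjN (h.trans hxj.symm))
    · intro h; exact absurd (Finset.mem_range.2 hjl) h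
  have c0m : P0.crossInc (framePt 1 (xm, km) (1 / 4 - 1 / 4 / 4) (1 / 4 / 2))
      (framePt 1 (xm, km) (1 / 4 + 1 / 4 / 4) (1 / 4 / 2)) = 0 := by
    rw [hP0, crossInc_arcPath hδ hη h4 xm km l (x0, k0)]
    refine Finset.sum_eq_zero fun i hi => if_neg fun h => ?_
    have := hinj i m ((Finset.mem_range.1 hi).trans hlN) hmN (h.trans hxm.symm)
    have := Finset.mem_range.1 hi
    omega
  -- test points off the loop
  have offC : ∀ {x : Site 2} {k : Fin 4}, quad x k ∉ CA →
      framePt 1 (x, k) (1 / 4 - 1 / 4 / 4) (1 / 4 / 2) ∉ range C ∧ framePt 1 (x, k) (1 / 4 + 1 / 4 / 4) (1 / 4 / 2) ∉ range C := by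
    intro x k hq
    obtain ⟨h1, h2⟩ := testPt_not_Γ x k N
    exact ⟨notC h1 (test_not_SA hq _ (left_mem_segment _ _ _)), notC h2 (test_not_SA hq _ (right_mem_segment _ _ _))⟩
  -- winding numbers: the jumps
  have hne2 : (2 * π * I : ℂ) ≠ 0 := by simp [Real.pi_ne_zero, I_ne_zero]
  have wj : wind (fun t => C.extend t - framePt 1 (xj, kj) (1 / 4 - 1 / 4 / 4) (1 / 4 / 2)) =
      wind (fun t => C.extend t - framePt 1 (xj, kj) (1 / 4 + 1 / 4 / 4) (1 / 4 / 2)) + 1 := by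
    obtain ⟨h1, h2⟩ := offC hQjA
    have h := Path.crossInc_loop C h1 h2
    rw [cross hQjA, c0j] at h
    have h3 := mul_right_cancel₀ hne2 ((one_mul _).trans h)
    have h4 := congrArg Complex.re h3
    simp only [sub_re, intCast_re, one_re] at h4
    have h5 : ((wind fun t => C.extend t - framePt 1 (xj, kj) (1 / 4 - 1 / 4 / 4) (1 / 4 / 2)) : ℝ) =
        wind (fun t => C.extend t - framePt 1 (xj, kj) (1 / 4 + 1 / 4 / 4) (1 / 4 / 2)) + 1 := by linarith
    exact_mod_cast h5
  have wm : wind (fun t => C.extend t - framePt 1 (xm, km) (1 / 4 - 1 / 4 / 4) (1 / 4 / 2)) =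
      wind (fun t => C.extend t - framePt 1 (xm, km) (1 / 4 + 1 / 4 / 4) (1 / 4 / 2)) := by
    obtain ⟨h1, h2⟩ := offC hQmA
    have h := Path.crossInc_loop C h1 h2
    rw [cross hQmA, c0m] at h
    rcases mul_eq_zero.1 h.symm with h3 | h3
    · have h4 := congrArg Complex.re h3
      simp only [sub_re, intCast_re, zero_re] at h4
      have h5 : ((wind fun t => C.extend t - framePt 1 (xm, km) (1 / 4 - 1 / 4 / 4) (1 / 4 / 2)) : ℝ) =
          wind (fun t => C.extend t - framePt 1 (xm, km) (1 / 4 + 1 / 4 / 4) (1 / 4 / 2)) := by linarith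
      exact_mod_cast h5
    · exact absurd h3 hne2
  -- winding numbers are constant along paths off the loop
  have hcont : ContinuousOn C.extend (Icc 0 1) := C.continuous_extend.continuousOn
  have h01 : C.extend 0 = C.extend 1 := by rw [Path.extend_zero, Path.extend_one]
  have hK : IsClosed (range C) := (isCompact_range C.continuous).isClosed
  have hmaps : MapsTo C.extend (Icc 0 1) (range C) := fun t ht => ⟨⟨t, ht⟩, (Path.extend_apply _ ht).symm⟩
  have const : ∀ {p q : ℂ}, JoinedIn (range C)ᶜ p q →
      wind (fun t => C.extend t - p) = wind (fun t => C.extend t - q) := fun h =>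
    wind_sub_eq_of_mem_connectedComponentIn hcont h01 hK hmaps (mem_connectedComponentIn_of_joinedIn h)
  -- inside: inner test point → lattice point
  have inner : ∀ {x : Site 2} {k : Fin 4}, quad x k ∉ CA →
      JoinedIn (range C)ᶜ (framePt 1 (x, k) (1 / 4 - 1 / 4 / 4) (1 / 4 / 2)) (meshPoint 1 x) := by
    intro x k hq
    rw [← framePt_origin x k]
    refine JoinedIn.of_segment_subset fun z hz => ?_
    obtain ⟨θ, hθ, rfl⟩ := exists_of_mem_segment_framePt hz
    refine notC (inside_not_mem_range hd₀ N ?_ ?_) ?_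
    · rw [abs_lt]; constructor <;> nlinarith [hθ.1, hθ.2]
    · rw [abs_lt]; constructor <;> nlinarith [hθ.1, hθ.2]
    · rcases hθ.2.eq_or_lt with rfl | hθ1
      · rw [show ((1 : ℝ) - 1) * (1 / 4 - 1 / 4 / 4) + 1 * 0 = 0 by ring,
          show ((1 : ℝ) - 1) * (1 / 4 / 2) + 1 * 0 = 0 by ring, framePt_origin]
        exact meshPoint_not_mem_closingSet' x
      · exact framePt_not_mem_closingSet' hq ⟨by nlinarith [hθ.1, hθ.2], by nlinarith [hθ.1, hθ.2]⟩
          ⟨by nlinarith [hθ.1, hθ.2], by nlinarith [hθ.1, hθ.2]⟩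
  -- inside: lattice point → lattice point along the edges of `E`
  have lattice : ∀ {x y : Site 2}, Relation.ReflTransGen (fun a b : Site 2 => s(a, b) ∈ E) x y →
      JoinedIn (range C)ᶜ (meshPoint 1 x) (meshPoint 1 y) := by
    intro x y hxy
    induction hxy with
    | refl =>
      refine JoinedIn.refl (notC ?_ (meshPoint_not_mem_closingSet' x))
      rw [← framePt_origin x 0]
      exact inside_not_mem_range hd₀ N (by norm_num) (by norm_num)
    | @tail b c _ hbc ih =>
      exact ih.trans (JoinedIn.of_segment_subset fun z hz =>
        notC (edge_not_mem_range hE hd₀ N hbc hz) (not_mem_closingSet'_of_mem_edge hE hextl hd₀ hbc hz))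
  -- outside: outer test point → centre of the exterior square
  have outer : ∀ {x : Site 2} {k : Fin 4}, quad x k ∉ CA → s(x, x + dir k) ∉ E →
      JoinedIn (range C)ᶜ (framePt 1 (x, k) (1 / 4 + 1 / 4 / 4) (1 / 4 / 2)) (ctr (quad x k)) := by
    intro x k hq hxk
    have h1 : JoinedIn (range C)ᶜ (framePt 1 (x, k) (1 / 4 + 1 / 4 / 4) (1 / 4 / 2))
        (framePt 1 (x, k) (1 / 2) (1 / 4 / 2)) := by
      refine JoinedIn.of_segment_subset fun z hz => ?_
      obtain ⟨s, hs, rfl⟩ := exists_of_mem_segment_fst (by norm_num) hz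
      exact notC (approach_not_mem_range hd₀ N ⟨by linarith [hs.1], hs.2⟩ ⟨by norm_num, by norm_num⟩)
        (framePt_not_mem_closingSet' hq ⟨by linarith [hs.1], by linarith [hs.2]⟩ ⟨by norm_num, by norm_num⟩)
    have h2 : JoinedIn (range C)ᶜ (framePt 1 (x, k) (1 / 2) (1 / 4 / 2)) (ctr (quad x k)) := by
      rw [ctr_quad]
      refine JoinedIn.of_segment_subset fun z hz => ?_
      obtain ⟨c, hc, rfl⟩ := exists_of_mem_segment_snd (by norm_num) hz
      exact notC (centerLine_not_mem_range hd₀ N hxk (abs_le.2 ⟨by linarith [hc.1], hc.2⟩))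
        (framePt_not_mem_closingSet' hq ⟨by norm_num, by norm_num⟩ ⟨by linarith [hc.1], by linarith [hc.2]⟩)
    exact h1.trans h2
  -- outside: the chain through `CB`
  obtain ⟨PB, hPB⟩ := exists_path_ctr (E := E) (S := (range C)ᶜ) (𝒞 := CB)
    (fun b hb => notC (ctr_not_mem_range hd₀ N b) (hSB _ (mem_closingSet_of_openSq hb (ctr_mem_openSq b))))
    (fun b i hb hb' hne z hz => notC (segment_ctr_not_mem_range hd₀ N hne hz)
      (hSB _ (segment_ctr_subset_closingSet hb hb' hne hz))) hjB hB
  have hjoinB : JoinedIn (range C)ᶜ (ctr (quad xj kj)) (ctr (quad xm km)) := by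
    refine ⟨PB, fun t => hPB _ ⟨t, rfl⟩⟩
  -- the contradiction
  have w_in := const ((inner hQjA).trans ((lattice (hconn xj hextj.1 xm hextm.1)).trans (inner hQmA).symm))
  have w_out := const (((outer hQjA hextj.2).trans hjoinB).trans (outer hQmA hextm.2).symm)
  omega

end WindowRect

/-- **Non-interleaving**, closed form (registered sub-goal of stmt-CriticalPhenomena-10650): for a connected
finite set `E` of lattice edges and an external dart `d₀` with boundary-tracing orbit with pairwise
distinct darts at the positions below `N`, positions `0 < j < l < m < N`, and two disjoint families of unit squares joining the exterior
squares of `d₀, d_l` resp. `d_j, d_m` by steps across sides not in `E` — `False`. [folklore] -/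
theorem windowRect_nonInterleave : ∀ {E : Finset (Sym2 (Site 2))}, (∀ e ∈ E, e ∈ (zdGraph 2).edgeSet) → (∀ x ∈ DiscreteRect.verts E, ∀ y ∈ DiscreteRect.verts E, Relation.ReflTransGen (fun a b : Site 2 => s(a, b) ∈ E) x y) → ∀ {d₀ : Site 2 × Fin 4}, DiscreteRect.IsExtDart E d₀ → ∀ {N : ℕ}, (∀ i j, i < N → j < N → (DiscreteRect.succ E)^[i] d₀ = (DiscreteRect.succ E)^[j] d₀ → i = j) → ∀ {j l m : ℕ}, 0 < j → j < l → l < m → m < N → ∀ {CA CB : Set (Site 2)}, Disjoint CA CB → DiscreteRect.quad d₀.1 d₀.2 ∈ CA → DiscreteRect.quad ((DiscreteRect.succ E)^[l] d₀).1 ((DiscreteRect.succ E)^[l] d₀).2 ∈ CA → DiscreteRect.quad ((DiscreteRect.succ E)^[j] d₀).1 ((DiscreteRect.succ E)^[j] d₀).2 ∈ CB → DiscreteRect.quad ((DiscreteRect.succ E)^[m] d₀).1 ((DiscreteRect.succ E)^[m] d₀).2 ∈ CB → Relation.ReflTransGen (fun p q : Site 2 => p ∈ CA ∧ q ∈ CA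 ∧ ∃ i : Fin 4, q = p + DiscreteRect.dir (i + 3) ∧ s(DiscreteRect.corner p i, DiscreteRect.corner p i + DiscreteRect.dir i) ∉ E) (DiscreteRect.quad ((DiscreteRect.succ E)^[l] d₀).1 ((DiscreteRect.succ E)^[l] d₀).2) (DiscreteRect.quad d₀.1 d₀.2) → Relation.ReflTransGen (fun p q : Site 2 => p ∈ CB ∧ q ∈ CB ∧ ∃ i : Fin 4, q = p + DiscreteRect.dir (i + 3) ∧ s(DiscreteRect.corner p i, DiscreteRect.corner p i + DiscreteRect.dir i) ∉ E) (DiscreteRect.quad ((DiscreteRect.succ E)^[j] d₀).1 ((DiscreteRect.succ E)^[j] d₀).2) (DiscreteRect.quad ((DiscreteRect.succ E)^[m] d₀).1 ((DiscreteRect.succ E)^[m] d₀).2) → False :=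
  fun hE hconn _ hd₀ _ hinj _ _ _ hj hjl hlm hmN _ _ hdis h0A hlA hjB hmB hA hB =>
    WindowRect.nonInterleave hE hconn hd₀ hinj hj hjl hlm hmN hdis h0A hlA hjB hmB hA hB

end Summit.CriticalPhenomena.SAWScalingLimit.Theorems.IsingBoundaryRatio

end
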